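import Literature.NumberTheory.Automorphic.UnitaryGroupPairCharactersDet
import Literature.NumberTheory.Automorphic.UnitaryGroupAdelicCharactersDetAllRanks
import Literature.NumberTheory.Automorphic.UnitaryGroupAdelicDiagSection
import HarnessLib

/-!
# Central characters of `U(V ⊗ W)(𝔸_{L⁺})` factor through `det`: rank `N = N · 1`, `N ≥ 3`, CM case — the predicate discharged

The rank-`N` edition of ✔ `UnitaryGroupAdelicCharactersDetPair` (rank `3 = 3 · 1`), verbatim with `3 ↦ N` and the rank-3 input
✔ `UnitaryGroup.AdelicCharactersDet.eq_comp_sec_comp_adelicDet` replaced by its rank-`N` edition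
✔ `UnitaryGroup.AdelicCharactersDetAllRanks.eq_comp_sec_comp_adelicDet` (general-rank engine ✔ `UnitaryIsotropicCharactersDet`).

[GelbartRogawski1991, §3.1 Remark p. 457 L9–13], printed for `G = U(3)`: "if `s*` is any other compatible splitting, then
`s* = s ⊗ ν′`, where `ν′` is an automorphic character of `E¹`, regarded as a character of `G`" — i.e. every continuous character
of `G(𝔸)` trivial on `G(F)` is `ν′ ∘ det`.  The tree DISPLAYS this as the predicate
`Liu2021.Def411WeilCarriersDoubling.CentralCharFactorsThroughDet F E c N M e J_V J_W hd`
(`Def411WeilCarriersSplittingDictionary`, the `hA` input of `exists_eq_chiSplittingLine_of_isCompatible`).  Here it is PROVED,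
with no residual hypothesis, for a CM field `L`, a real nonsingular diagonal `J_V = diag dV` of ANY rank `N ≥ 3`, a real nonzero
hermitian line `J_W` and any enumeration `e : Fin N × Fin 1 ≃ Fin N`:

* `UnitaryGroup.AdelicCharactersDetAllRanks.centralCharFactorsThroughDet_rank` (and `…_of_map` for `J_W = T_W ⊗ 1`).

Assembly, nothing else: `reindex e (diag dV ⊗ J_W) = diag d` (✔ `reindex_kronecker_diagonal`, `eq_diagonal_of_fin_one`); on
`U(diag d)(𝔸_{L⁺})` every continuous character kills `SU` at every place and factors through `det` along any section
(✔ `AdelicCharactersDetAllRanks.eq_comp_sec_comp_adelicDet`); the diagonal section `u ↦ diag(u, 1, …, 1)` (✔ `UnitaryGroup.adelicDiagSection`,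
index `⟨0, _⟩ : Fin N`); and the pair adapter ✔ `UnitaryGroup.centralCharFactorsThroughDet_of_adelic`.  Kernel only: 0 records, 0 named
facts, 0 sorry.  Written for the pub-hodgecm2 (COR-CM) lineage b10 (the rank-4 faces).  HC_CM is NOT proved.
-/

set_option autoImplicit false

noncomputable section

open scoped Matrix Kronecker
open NumberField
open Literature.NumberTheory.GelbartRogawski1991.GRConstruction

namespace Literature.NumberTheory.Automorphic.UnitaryGroup.AdelicCharactersDetAllRanks

variable (L : Type) [Field L] [NumberField L] [IsCMField L] {N : ℕ} (hN3 : 3 ≤ N)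

include hN3 in
/-- **X3-Char item (A) in the pair currency, rank `N = N · 1`, `N ≥ 3`, CM case — NO residual hypothesis.**  For a CM field `L`, a real
nonsingular diagonal `J_V = diag dV` of rank `N ≥ 3`, a real nonzero hermitian line `J_W` (`1 × 1`) and any enumeration
`e : Fin N × Fin 1 ≃ Fin N`, the displayed predicate `CentralCharFactorsThroughDet L⁺ L c̄ N 1 e (diag dV) J_W hd` HOLDS: every continuous
character of `G₁(𝔸_{L⁺}) = U(J_V ⊗ J_W)(𝔸_{L⁺})` trivial on `G₁(L⁺)` is `α ∘ det` for a continuous unitary automorphic `α`.  Assembly of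
✔ `AdelicCharactersDetAllRanks.eq_comp_sec_comp_adelicDet` (`SU(N)` is killed at every place) along the diagonal section
`adelicDiagSection … ⟨0, _⟩` through the pair adapter `centralCharFactorsThroughDet_of_adelic`. [cite: GelbartRogawski1991, §3.1 Remark p. 457 L9–13] -/
theorem centralCharFactorsThroughDet_rank (e₁ : Fin N × Fin 1 ≃ Fin N) (dV : Fin N → L)
    (hdV : ∀ i, IsCMField.complexConj L (dV i) = dV i) (hdV0 : ∀ i, dV i ≠ 0) (JW : Matrix (Fin 1) (Fin 1) L)
    (hJW : IsCMField.complexConj L (JW 0 0) = JW 0 0) (hJW0 : JW 0 0 ≠ 0)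
    (hd : (Matrix.reindex e₁ e₁ (Matrix.diagonal dV ⊗ₖ JW)).det ≠ 0) :
    Liu2021.Def411WeilCarriersDoubling.CentralCharFactorsThroughDet (Fp L) L (IsCMField.complexConj L) N 1 e₁
      (Matrix.diagonal dV) JW hd := by
  have i₀ : Fin N := ⟨0, by omega⟩
  have hJ₀ : Matrix.reindex e₁ e₁ (Matrix.diagonal dV ⊗ₖ JW) =
      Matrix.diagonal fun k => dV (e₁.symm k).1 * JW 0 0 := by
    conv_lhs => rw [eq_diagonal_of_fin_one L JW]
    exact reindex_kronecker_diagonal L N 1 e₁ dV fun _ => JW 0 0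
  have hdreal : ∀ k, IsCMField.complexConj L (dV (e₁.symm k).1 * JW 0 0) = dV (e₁.symm k).1 * JW 0 0 := fun k => by
    rw [map_mul, hdV, hJW]
  have hd0' : ∀ k, dV (e₁.symm k).1 * JW 0 0 ≠ 0 := fun k => mul_ne_zero (hdV0 _) hJW0
  have hdet : (Matrix.diagonal fun k => dV (e₁.symm k).1 * JW 0 0).det ≠ 0 := by
    rw [← hJ₀]; exact hd
  exact centralCharFactorsThroughDet_of_adelic (Fp L) L (IsCMField.complexConj L) N 1 e₁ (Matrix.diagonal dV) JW
    (Algebra.IsQuadraticExtension.finrank_eq_two _ L) (IsCMField.complexConj_ne_one (K := L)) hd hJ₀ hdet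
    (adelicDiagSection (Fp L) L (IsCMField.complexConj L) N _ i₀)
    (continuous_adelicDiagSection (Fp L) L (IsCMField.complexConj L) N _ i₀)
    (adelicDiagSection_mem_range_toAdelic (Fp L) L (IsCMField.complexConj L) N _ i₀)
    fun χ hχ => AdelicCharactersDetAllRanks.eq_comp_sec_comp_adelicDet L hN3 _ hdreal hd0' hdet _
      (adelicDet_adelicDiagSection (Fp L) L (IsCMField.complexConj L) N _ i₀ hdet) χ hχ

include hN3 in
/-- the same for the hermitian line given REALLY: `J_W = T_W ⊗ 1` with `T_W ∈ M₁(L⁺)`, `det T_W` a unit (the line Gram datum of the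
pin's `splittingDatum`; realness and non-vanishing of `J_W 0 0` are then automatic). [cite: GelbartRogawski1991, §3.1 Remark p. 457 L9–13] -/
theorem centralCharFactorsThroughDet_rank_of_map (e₁ : Fin N × Fin 1 ≃ Fin N) (dV : Fin N → L)
    (hdV : ∀ i, IsCMField.complexConj L (dV i) = dV i) (hdV0 : ∀ i, dV i ≠ 0)
    (TW : Matrix (Fin 1) (Fin 1) (Fp L)) (hWd : IsUnit TW.det) (JW : Matrix (Fin 1) (Fin 1) L)
    (hJW : JW = TW.map (algebraMap (Fp L) L))
    (hd : (Matrix.reindex e₁ e₁ (Matrix.diagonal dV ⊗ₖ JW)).det ≠ 0) :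
    Liu2021.Def411WeilCarriersDoubling.CentralCharFactorsThroughDet (Fp L) L (IsCMField.complexConj L) N 1 e₁
      (Matrix.diagonal dV) JW hd := by
  have h00 : JW 0 0 = algebraMap (Fp L) L (TW 0 0) := by
    rw [hJW, Matrix.map_apply]
  refine centralCharFactorsThroughDet_rank L hN3 e₁ dV hdV hdV0 JW ?_ ?_ hd
  · rw [h00]
    exact IsCMField.complexConj_apply_eq_self (K := L) (TW 0 0)
  · rw [h00]
    have hT : TW 0 0 ≠ 0 := by
      rw [Matrix.det_fin_one] at hWd
      exact hWd.ne_zero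
    exact fun h => hT ((algebraMap (Fp L) L).injective (h.trans (map_zero _).symm))

end Literature.NumberTheory.Automorphic.UnitaryGroup.AdelicCharactersDetAllRanks

end
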